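import Literature.Probability.LatticeModels.KilledWalkLaplacian
import HarnessLib

/-!
# Ratio bounds and hubs for killed-harmonic functions (edge-killed walk on `ℤ²`)

Topic `Literature/Probability/LatticeModels` (continuation of `KilledWalkLaplacian.lean`). Three
elementary devices of the boundary Harnack programme for the edge-killed walk (Chelkak 2016 §3;
Chelkak–Wan 2021 §3.2), all proved by the maximum principle of `KilledWalkLaplacian.lean`:

* `IsKilledHarmonicOn.le_mul_of_forall_boundary` / `mul_le_of_forall_boundary` — **ratio hull
  principle**: for `f, g ≥ 0` killed-harmonic on a finite `S`, an inequality `f ≤ c g`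
  (resp. `c g ≤ f`) on the exit set `killedOuterBoundary Gr S` propagates to `S`; so `f/g` on `S`
  lies between its extrema over any separating exit set (the device behind "fjords never increase
  the oscillation of a ratio of two kernels fed from outside");
* `IsKilledSuperharmonicOn.le_four_mul_of_adj` — a nonnegative killed-superharmonic function changes
  by a factor at most `4` along a kept edge (`h(v+e) ≤ 4 h(v)`);
* `exists_hub_index` — the **discrete intermediate value step** producing a hub: along a chain
  `a₀, …, aₙ` with `a₀ ≥ 1/4`, `a_{i+1} ≥ a_i/4`, and `a_i + b_i ≥ 1/2`, `bₙ ≥ 1/4`, some index has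
  `a_i ≥ 1/16` and `b_i ≥ 1/4` (applied to the harmonic measures of the two sides of an annular
  quadrilateral along a kept path joining them: Chelkak 2016, Lemma 3.4 / Theorem 3.5 hypothesis).

Everything is proved. [cite: Chelkak2016, §3 (Lemma 3.4, Thm. 3.5)]
-/

noncomputable section

open scoped Classical

namespace Literature.Probability.LatticeModels

open Finset

variable {Gr : SimpleGraph (Site 2)}

/-! ### Ratio hull principle -/

/-- **Ratio hull principle (upper).** If `f, g` are killed-harmonic on the finite set `S` and
`f ≤ c·g` on its exit set, with `c ≥ 0` and `g ≥ 0` off… precisely `f w ≤ c * g w` for every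
`w ∈ killedOuterBoundary Gr S`, then `f ≤ c·g` on `S`. [folklore] -/
theorem IsKilledHarmonicOn.le_mul_of_forall_boundary {f g : Site 2 → ℝ} {S : Set (Site 2)} (hS : S.Finite)
    (hf : IsKilledHarmonicOn Gr f S) (hg : IsKilledHarmonicOn Gr g S) {c : ℝ}
    (hbd : ∀ w ∈ killedOuterBoundary Gr S, f w ≤ c * g w) : ∀ v ∈ S, f v ≤ c * g v := by
  have hsub : IsKilledSubharmonicOn Gr (f - fun x => c * g x) S := by
    intro v hv
    rw [killedAvg_sub, killedAvg_const_mul, Pi.sub_apply, ← hf v hv, ← hg v hv]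
  have key := hsub.le_of_forall_boundary_le hS (M := 0) le_rfl fun w hw => by
    rw [Pi.sub_apply]; linarith [hbd w hw]
  intro v hv
  have := key v hv
  rw [Pi.sub_apply] at this
  linarith

/-- **Ratio hull principle (lower).** If `c·g ≤ f` on the exit set then `c·g ≤ f` on `S`. [folklore] -/
theorem IsKilledHarmonicOn.mul_le_of_forall_boundary {f g : Site 2 → ℝ} {S : Set (Site 2)} (hS : S.Finite)
    (hf : IsKilledHarmonicOn Gr f S) (hg : IsKilledHarmonicOn Gr g S) {c : ℝ}
    (hbd : ∀ w ∈ killedOuterBoundary Gr S, c * g w ≤ f w) : ∀ v ∈ S, c * g v ≤ f v := by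
  have hsup : IsKilledSuperharmonicOn Gr (f - fun x => c * g x) S := by
    intro v hv
    rw [killedAvg_sub, killedAvg_const_mul, Pi.sub_apply, ← hf v hv, ← hg v hv]
  have key := hsup.ge_of_forall_boundary_ge hS (m := 0) le_rfl fun w hw => by
    rw [Pi.sub_apply]; linarith [hbd w hw]
  intro v hv
  have := key v hv
  rw [Pi.sub_apply] at this
  linarith

/-- **Cross-ratio form of the hull principle.** For `f, g` killed-harmonic on the finite `S` with
`g ≥ 0`: if `f w * g w' ≤ C * (f w' * g w)` for all exit points `w, w'` (the cross-ratio of the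
boundary data is at most `C`), then `f v * g w' ≤ C * (f w' * g v)` for all `v ∈ S` and all exit
points `w'` — one interior point. [folklore] -/
theorem IsKilledHarmonicOn.crossRatio_boundary_interior {f g : Site 2 → ℝ} {S : Set (Site 2)} (hS : S.Finite)
    (hf : IsKilledHarmonicOn Gr f S) (hg : IsKilledHarmonicOn Gr g S) {C : ℝ}
    (hbd : ∀ w ∈ killedOuterBoundary Gr S, ∀ w' ∈ killedOuterBoundary Gr S, f w * g w' ≤ C * (f w' * g w))
    {w' : Site 2} (hw' : w' ∈ killedOuterBoundary Gr S) (hgw' : 0 ≤ g w') :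
    ∀ v ∈ S, f v * g w' ≤ C * (f w' * g v) := by
  intro v hv
  rcases eq_or_lt_of_le hgw' with h0 | hpos
  · -- `g w' = 0`: the boundary inequality gives `0 ≤ C f w' g` on the exit set, hence on `S`
    rw [← h0, mul_zero]
    have hharm : IsKilledHarmonicOn Gr (fun x => C * f w' * g x) S := fun u hu => by
      rw [killedAvg_const_mul, ← hg u hu]
    have hb : ∀ w ∈ killedOuterBoundary Gr S, (0 : ℝ) * g w ≤ C * f w' * g w := fun w hw => by
      have := hbd w hw w' hw'
      rw [← h0, mul_zero] at this
      rw [zero_mul]; linarith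
    have := IsKilledHarmonicOn.mul_le_of_forall_boundary hS hharm hg hb v hv
    rw [zero_mul] at this
    linarith
  · -- `g w' > 0`: apply the upper hull to `f` and `(C f w' / g w') · g`
    have hb : ∀ w ∈ killedOuterBoundary Gr S, f w ≤ (C * f w' / g w') * g w := fun w hw => by
      rw [div_mul_eq_mul_div, le_div_iff₀ hpos]
      linarith [hbd w hw w' hw']
    have := IsKilledHarmonicOn.le_mul_of_forall_boundary hS hf hg hb v hv
    rw [div_mul_eq_mul_div, le_div_iff₀ hpos] at this
    linarith

/-! ### One kept edge changes a nonnegative superharmonic function by a factor at most four -/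

/-- Along a kept edge a nonnegative killed-superharmonic function satisfies `h (v + e) ≤ 4 h v`.
[folklore] -/
theorem IsKilledSuperharmonicOn.le_four_mul_of_adj {h : Site 2 → ℝ} {S : Set (Site 2)}
    (H : IsKilledSuperharmonicOn Gr h S) (hnn : ∀ w, 0 ≤ h w) {v : Site 2} (hv : v ∈ S) {e : SRW.Dir 2}
    (he : Gr.Adj v (v + SRW.stepVec e)) : h (v + SRW.stepVec e) ≤ 4 * h v := by
  have h1 : killedAvg Gr h v ≤ h v := H v hv
  have h2 : 4⁻¹ * h (v + SRW.stepVec e) ≤ killedAvg Gr h v := by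
    rw [killedAvg]
    refine mul_le_mul_of_nonneg_left ?_ (by norm_num)
    rw [← Finset.sum_erase_add _ _ (Finset.mem_univ e), if_pos he]
    have : 0 ≤ ∑ x ∈ Finset.univ.erase e, (if Gr.Adj v (v + SRW.stepVec x) then h (v + SRW.stepVec x) else 0) :=
      Finset.sum_nonneg fun x _ => by split_ifs <;> [exact hnn _; exact le_rfl]
    linarith
  linarith

/-! ### The discrete intermediate value step -/

/-- **Hub index.** Let `a, b : ℕ → ℝ` with `a 0 ≥ 1/4`, `b n ≥ 1/4`, `a (i+1) ≥ a i / 4` for `i < n`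
and `a i + b i ≥ 1/2` for `i ≤ n`. Then some `i ≤ n` has `a i ≥ 1/16` and `b i ≥ 1/4`. [folklore] -/
theorem exists_hub_index {a b : ℕ → ℝ} {n : ℕ} (ha0 : 1 / 4 ≤ a 0) (hbn : 1 / 4 ≤ b n)
    (hstep : ∀ i < n, a i / 4 ≤ a (i + 1)) (hsum : ∀ i ≤ n, 1 / 2 ≤ a i + b i) :
    ∃ i ≤ n, 1 / 16 ≤ a i ∧ 1 / 4 ≤ b i := by
  by_cases hall : ∀ i ≤ n, 1 / 4 ≤ a i
  · exact ⟨n, le_rfl, by linarith [hall n le_rfl], hbn⟩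
  · push Not at hall
    -- the first index where `a` drops below `1/4`
    classical
    let P : ℕ → Prop := fun i => i ≤ n ∧ a i < 1 / 4
    have hex : ∃ i, P i := by obtain ⟨i, hi, hai⟩ := hall; exact ⟨i, hi, hai⟩
    set i₀ := Nat.find hex with hi₀
    obtain ⟨hi₀n, hai₀⟩ : P i₀ := Nat.find_spec hex
    have hpos : 0 < i₀ := by
      by_contra h0
      have : i₀ = 0 := by omega
      rw [this] at hai₀
      linarith
    have hprev : ¬ P (i₀ - 1) := Nat.find_min hex (by omega)
    have hprev' : 1 / 4 ≤ a (i₀ - 1) := by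
      by_contra hlt; push Not at hlt; exact hprev ⟨by omega, hlt⟩
    have hst := hstep (i₀ - 1) (by omega)
    rw [show i₀ - 1 + 1 = i₀ by omega] at hst
    refine ⟨i₀, hi₀n, by linarith, ?_⟩
    linarith [hsum i₀ hi₀n]

end Literature.Probability.LatticeModels
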